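import Literature.MathematicalPhysics.QuantumFieldTheory.Balaban1983to89.B1Eq230FluctCov
import Literature.MathematicalPhysics.QuantumFieldTheory.Balaban1983to89.HiggsFluctMeasureCov

/-!
# `Balaban1983to89.B1Eq230FluctCovPos` — T. Bałaban, *(Higgs)₂,₃ quantum fields in a finite volume. I. A lower bound*,
Commun. Math. Phys. **85** (1982) 603–626 [Balaban1982Higgs1] pp. 610–611: the operator `a(L^{k+1}ε)^{−2}P(A) + Δ^{(k),L^kε}(Ω, A)`
inverted in (2.30) is SYMMETRIC and POSITIVE DEFINITE for the scalar product (1.5) — for the CONCRETE model, an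
ARBITRARY external vector field `A`, region `Ω ⊂ T_ε` and coupling `U(A) = exp(qεeA)` (m² > 0, a > 0, L > 1, k ≤ K) —
the qualitative half of (2.33), whence *"It is so"* (p. 611) at every level `k ≤ K` and `C^{(k),L^kε}(Ω, A) > 0`;
theorems only, companion of p35's `B1Eq230FluctCov`

statement-level skeleton of published theorems with citation tags; proofs where landed; nothing here is a claim about the Yang–Mills mass gap

PDF held: `paper:balaban1982-cmp85-higgs23-i` (journal page = PDF page + 602); pp. 608–611 [PDF 6–9] read AS IMAGES on the
×2 renders `run/shared/lean/pub/pub-balaban/b2b-balaban-ref1/pages/1982-cmp85-higgs23-I/1982-cmp85-higgs23-I-p006…p009-x2.png`.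

CITATION HEADER (lean-in-tree rule).  lit-balaban typed skeleton (HOME `run/shared/lean/pub/lit-balaban/`), typer line
(concrete carriers), gen 5; file 1 of 2 (file 2 `HiggsCondCov232`: the conditional covariances (2.32)).  SKELETON row
served: **B1.Eq2.30** (owners r01/r14), the qualitative member of (2.33) and the sentence *"It is so"*; NO decl of record
is restated: `Δ^{(k),L^kε}(Ω,A)`, the one-step `P(A) = Q^*(A)Q(A)`, the operator of (2.30) and `C^{(k),L^kε}(Ω,A)` for
general `A` ARE p35's `B1Eq230FluctCov.deltaKA`/`blockProjA`/`precOpA`/`fluctCovA` (consumed BY NAME; p35's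
`isUnit_precOpA` — levels `1 ≤ k`, via the abstract `B1RG242` — is complemented, not redone); the typer's
`HiggsFluctMeasurePos`/`HiggsFluctMeasureCov` are the case `A = 0`, `N = d`, `Ω = T` of the present theorems.
THE SOURCE TEXT, verbatim.  p. 610 [PDF 8]: *"G^ε_k(Ω, A) = (−Δ^{ε,N}_{A,Ω} + m² + a_k(L^kε)^{−2}P_k(A))^{−1}, P_k(A) =
Q^*_k(A)Q_k(A), (2.20) … ⟨ψ, Δ^{(k),L^kε}(Ω, A)ψ⟩ = a_k(L^kε)^{−2}⟨ψ,ψ⟩ − a_k²(L^kε)^{−4}⟨ψ, Q_k(A)G^ε_k(Ω, A)Q^*_k(A)ψ⟩.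
(2.21)"*; p. 611 [PDF 9]: *"C^{(k),L^kε}(Ω, A) = (a(L^{k+1}ε)^{−2}P(A) + Δ^{(k),L^kε}(Ω, A))^{−1}. (2.30) … It is not clear
from the formulas (2.30), (2.31) that the covariances are well defined. It is so, and it is one of the assertions of
Proposition 2.3."*; Prop. 2.3: *"there exist positive constants δ₀, c₀, γ₀, γ₁, dependent on d and a, and independent of
A, k, Ω and Λ, such that γ₀I ≦ aL^{−2}P(A) + Δ^{(k)}(Ω, A) ≦ γ₁I, (2.33)"*; p. 605 [PDF 3]: *"Antisymmetry of q implies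
U(A)^* = U(−A) = U(−A)^{−1}"*.

WHAT THIS FILE PROVES (0 sorry; standard axioms; theorems only).
§1 SYMMETRY for (1.5), general `A`, `Ω`, `C`: of the operator of (2.20) (`siteInner_covOpK_comm`), of `G^ε_k(Ω,A)`
   (`siteInner_propagatorK_comm`), of `Q_kG^ε_kQ^*_k` and `Δ^{(k)}(Ω,A)` ((2.21) as a quadratic form
   `siteInner_deltaKA_succ`; `siteInner_deltaKA_comm`), of `P(A)` (`siteInner_blockProjA_eq`: `⟨f, P(A)g⟩ = ⟨Q(A)f, Q(A)g⟩`),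
   of the operator of (2.30) (`siteInner_precOpA_comm`) and of `C^{(k)}(Ω,A)` (`siteInner_fluctCovA_comm`).
§2 POSITIVITY (the qualitative content of (2.33) — NO uniform `γ₀`): `Q^*_k(A)` injective for `k ≤ K` (unitarity of
   `U`, `B1Eq27StepAdjoint.U_star_U_apply`), `P(A) ≥ 0`, `Δ^{(0)}(Ω,A) ≥ m²`, `Δ^{(k)}(Ω,A) > 0` for `1 ≤ k ≤ K`
   (`siteInner_deltaKA_succ_pos`: the variational inequality `a_k(L^kε)^{−2}⟨Q^*_kψ, G^ε_kQ^*_kψ⟩ < ⟨ψ,ψ⟩` — port of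
   `HiggsFluctMeasurePos` §4 from `U = 1` to the unitary transports `U(A(Γ))`), **`siteInner_precOpA_pos`** (m² > 0,
   a > 0, L > 1, k ≤ K), whence `isUnit_precOpA_of_le` (*"It is so"* also at `k = 0`), the two-sided inverse identities
   with hypotheses discharged, and **`siteInner_fluctCovA_pos`** (`C^{(k)}(Ω,A) > 0`).
§3 the unit-lattice letters of (2.31): on `Params.unitAt k` the coefficients ARE the printed `aL^{−2}` and `a_k`.
HONEST SCOPE.  As in p35's files the operators act on fields on ALL of `T^{(k)}` resp. `T_ε` (mass term everywhere, bonds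
outside `Ω` dropped), so for `Ω ⊊ T_ε` only m² > 0 is covered; levels `k ≤ K` (the tori are meaningful there); nothing
quantitative — the uniform constants `γ₀, γ₁` of (2.33) are NOT touched.  Value = kernel certificates for the concrete
objects; NOT summit progress.  Unit `lit-balaban-typer` gen 5 (literature-prover-lit-balaban-typer-g5-0); HOME/FILED.md
records the proposal.
-/

open scoped BigOperators InnerProductSpace

namespace Literature.MathematicalPhysics.QuantumFieldTheory.Balaban1983to89.B1Eq230FluctCovPos

open HiggsLattice HiggsAveraging HiggsAveragingCompose HiggsCovariance HiggsCovariancePos HiggsCovarianceCont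
  HiggsFluctMeasure HiggsFluctMeasurePos HiggsFluctMeasureCov B1Eq27StepAdjoint B1Eq230FluctCov

variable {P : HiggsLattice.Params} {N : ℕ}

/-! ## §1 Symmetry for (1.5) of the operators of (2.20), (2.21), (2.30), general `A` -/

section Symmetry

variable (C : ChargeData N) (Ω : Finset (HiggsLattice.Site P 0)) (A : HiggsLattice.VecField P 0) (msq a : ℝ)

/-- The operator of (2.20) with the coefficient written `a_k(L^kε)^{−2}` = `HiggsFluctMeasure.coeff221`:
`−Δ^{ε,N}_{A,Ω} + m² + a_k(L^kε)^{−2}Q^*_k(A)Q_k(A)` (definitional unfolding of `HiggsCovariance.covOpK`).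
[cite: Balaban1982Higgs1, (2.20) p.610] -/
theorem covOpK_eq_coeff221 (k : ℕ) :
    covOpK C Ω A msq a k
      = covLaplacianN C Ω A + msq • LinearMap.id + coeff221 P a k • (avgQkAdj C A k ∘ₗ avgQkLin C A k) := rfl

/-- `⟨f, P_k(A)g⟩ = ⟨Q_k(A)f, Q_k(A)g⟩` ((2.20): `Q^*_k(A)` is the (1.5)-adjoint of `Q_k(A)`,
`HiggsCovariancePos.siteInner_avgQkLin`). [cite: Balaban1982Higgs1, (2.20) p.610] -/
theorem siteInner_projPk_eq (k : ℕ) (f g : ScalarField P 0 N) :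
    siteInner f (avgQkAdj C A k (avgQkLin C A k g)) = siteInner (avgQkLin C A k f) (avgQkLin C A k g) := by
  rw [← siteInner_avgQkLin]

/-- **The operator of (2.20) is symmetric** for (1.5), for every external field `A` and region `Ω` (`−Δ^{ε,N}_{A,Ω}`
self-adjoint, p. 609; `Q^*_kQ_k` symmetric by adjointness). [cite: Balaban1982Higgs1, (2.20) p.610] -/
theorem siteInner_covOpK_comm (k : ℕ) (f g : ScalarField P 0 N) :
    siteInner f (covOpK C Ω A msq a k g) = siteInner g (covOpK C Ω A msq a k f) := by
  simp only [covOpK_eq_coeff221, LinearMap.add_apply, LinearMap.smul_apply, LinearMap.id_apply,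
    LinearMap.comp_apply, siteInner_add_right, siteInner_smul_right]
  rw [siteInner_covLaplacianN_comm, siteInner_projPk_eq, siteInner_projPk_eq, siteInner_comm f g,
    siteInner_comm (avgQkLin C A k f)]

/-- **`G^ε_k(Ω, A)` is symmetric** for (1.5) (the inverse of a symmetric operator; `HiggsFluctMeasureCov.siteInner_inverse_comm`).
[cite: Balaban1982Higgs1, (2.20) p.610] -/
theorem siteInner_propagatorK_comm (k : ℕ) (f g : ScalarField P 0 N) :
    siteInner f (propagatorK C Ω A msq a k g) = siteInner g (propagatorK C Ω A msq a k f) :=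
  siteInner_inverse_comm _ (siteInner_covOpK_comm C Ω A msq a k) f g

/-- `⟨f, Q_k(A)G^ε_k(Ω,A)Q^*_k(A)g⟩ = ⟨g, Q_k(A)G^ε_k(Ω,A)Q^*_k(A)f⟩` — the operator of the solved form (2.21) is symmetric
(adjointness (2.20) twice and the symmetry of `G^ε_k`). [cite: Balaban1982Higgs1, (2.21) p.610] -/
theorem siteInner_QGQ_comm (k : ℕ) (f g : ScalarField P k N) :
    siteInner f (avgQkLin C A k (propagatorK C Ω A msq a k (avgQkAdj C A k g)))
      = siteInner g (avgQkLin C A k (propagatorK C Ω A msq a k (avgQkAdj C A k f))) := by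
  rw [siteInner_comm f, siteInner_avgQkLin, siteInner_comm _ (avgQkAdj C A k f), siteInner_propagatorK_comm,
    siteInner_comm (avgQkAdj C A k g), ← siteInner_avgQkLin, siteInner_comm _ g]

/-- **(2.21) as printed, a statement about quadratic forms**, general `A`, `Ω`: for `k ≥ 1`,
`⟨ψ, Δ^{(k),L^kε}(Ω,A)ψ⟩ = a_k(L^kε)^{−2}⟨ψ,ψ⟩ − a_k²(L^kε)^{−4}⟨ψ, Q_k(A)G^ε_k(Ω,A)Q^*_k(A)ψ⟩` (unfolding of p35's
`B1Eq230FluctCov.deltaKA`). [cite: Balaban1982Higgs1, (2.21) p.610] -/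
theorem siteInner_deltaKA_succ (j : ℕ) (ψ : ScalarField P (j + 1) N) :
    siteInner ψ (deltaKA C Ω A msq a (j + 1) ψ)
      = coeff221 P a (j + 1) * siteInner ψ ψ
        - coeff221 P a (j + 1) ^ 2 *
          siteInner ψ (avgQkLin C A (j + 1) (propagatorK C Ω A msq a (j + 1) (avgQkAdj C A (j + 1) ψ))) := by
  rw [deltaKA_succ, LinearMap.sub_apply, LinearMap.smul_apply, LinearMap.smul_apply, LinearMap.id_apply,
    LinearMap.comp_apply, LinearMap.comp_apply, siteInner_sub_right, siteInner_smul_right, siteInner_smul_right]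

/-- **`Δ^{(k),L^kε}(Ω, A)` is symmetric** for (1.5) — `k = 0`: (2.17); `k ≥ 1`: the solved form (2.21).
[cite: Balaban1982Higgs1, (2.21) p.610] -/
theorem siteInner_deltaKA_comm : ∀ (j : ℕ) (f g : ScalarField P j N),
    siteInner f (deltaKA C Ω A msq a j g) = siteInner g (deltaKA C Ω A msq a j f)
  | 0, f, g => by
      simp only [deltaKA_zero, delta0, LinearMap.add_apply, LinearMap.smul_apply, LinearMap.id_apply,
        siteInner_add_right, siteInner_smul_right]
      rw [siteInner_covLaplacianN_comm, siteInner_comm f g]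
  | j + 1, f, g => by
      simp only [deltaKA_succ, LinearMap.sub_apply, LinearMap.smul_apply, LinearMap.id_apply, LinearMap.comp_apply,
        siteInner_sub_right, siteInner_smul_right]
      rw [siteInner_comm f g, siteInner_QGQ_comm]

/-- `⟨f, P(A)g⟩ = ⟨Q(A)f, Q(A)g⟩` for the ONE-step `P(A) = Q^*(A)Q(A)` of (2.30) (`B1Eq27StepAdjoint.siteInner_avgQLin`).
[cite: Balaban1982Higgs1, (2.30) p.611] -/
theorem siteInner_blockProjA_eq (j : ℕ) (f g : ScalarField P j N) :
    siteInner f (blockProjA C A j g) = siteInner (avgQLin C A j f) (avgQLin C A j g) := by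
  rw [blockProjA, LinearMap.comp_apply, ← siteInner_avgQLin]

/-- **`P(A)` is symmetric** for (1.5). [cite: Balaban1982Higgs1, (2.30) p.611] -/
theorem siteInner_blockProjA_comm (j : ℕ) (f g : ScalarField P j N) :
    siteInner f (blockProjA C A j g) = siteInner g (blockProjA C A j f) := by
  rw [siteInner_blockProjA_eq, siteInner_blockProjA_eq, siteInner_comm]

/-- **`P(A) ≥ 0`**: `0 ≤ ⟨f, P(A)f⟩ = |Q(A)f|²`. [cite: Balaban1982Higgs1, (2.30) p.611] -/
theorem siteInner_blockProjA_nonneg (j : ℕ) (f : ScalarField P j N) : 0 ≤ siteInner f (blockProjA C A j f) := by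
  rw [siteInner_blockProjA_eq]
  exact siteInner_self_nonneg _

/-- **The operator `a(L^{k+1}ε)^{−2}P(A) + Δ^{(k),L^kε}(Ω,A)` of (2.30) is symmetric** for (1.5), every `A`, `Ω`, `C`.
[cite: Balaban1982Higgs1, (2.30) p.611] -/
theorem siteInner_precOpA_comm (j : ℕ) (f g : ScalarField P j N) :
    siteInner f (precOpA C Ω A msq a j g) = siteInner g (precOpA C Ω A msq a j f) := by
  rw [precOpA]
  simp only [LinearMap.add_apply, LinearMap.smul_apply, siteInner_add_right, siteInner_smul_right]
  rw [siteInner_blockProjA_comm, siteInner_deltaKA_comm]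

/-- **`C^{(k),L^kε}(Ω, A)` (2.30) is symmetric** for (1.5). [cite: Balaban1982Higgs1, (2.30) p.611] -/
theorem siteInner_fluctCovA_comm (j : ℕ) (f g : ScalarField P j N) :
    siteInner f (fluctCovA C Ω A msq a j g) = siteInner g (fluctCovA C Ω A msq a j f) :=
  siteInner_inverse_comm _ (siteInner_precOpA_comm C Ω A msq a j) f g

end Symmetry

/-! ## §2 Positivity: the operator of (2.30) is positive definite (qualitative half of (2.33)); *"It is so"* -/

section Positivity

variable (C : ChargeData N) (Ω : Finset (HiggsLattice.Site P 0)) (A : HiggsLattice.VecField P 0)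

/-- Pointwise formula of `Q^*_k(A)` ((2.20), `HiggsCovariance.avgQkAdj`): `(Q^*_k(A)ψ)(x) = U(A(Γ^{(k)}_{x_k,x}))^*ψ(x_k)`.
[cite: Balaban1982Higgs1, (2.20) p.610] -/
theorem avgQkAdj_apply_eq (k : ℕ) (ψ : ScalarField P k N) (x : HiggsLattice.Site P 0) :
    avgQkAdj C A k ψ x = star (C.U (P.mesh 0) (multiContourSum A k x)) (ψ (blockIter k x)) := by
  simp [avgQkAdj]

/-- **`Q^*_k(A)` is injective for `k ≤ K`**, every external field `A` (every site of `T^{(k)}` is a block point,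
`HiggsFluctMeasurePos.blockIter_surjective`; the transports are unitary, `UU^* = 1`, p. 605). [cite: Balaban1982Higgs1, (2.20) p.610] -/
theorem eq_zero_of_avgQkAdj_eq_zero {k : ℕ} (hk : k ≤ P.K) {ψ : ScalarField P k N} (h : avgQkAdj C A k ψ = 0) :
    ψ = 0 := by
  funext y
  obtain ⟨x, rfl⟩ := blockIter_surjective hk y
  have hx := congrFun h x
  rw [avgQkAdj_apply_eq, Pi.zero_apply] at hx
  rw [Pi.zero_apply, ← U_star_U_apply C (P.mesh 0) (multiContourSum A k x) (ψ (blockIter k x)), hx, map_zero]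

/-- **`Δ^{(0),ε}(Ω, A) = −Δ^{ε,N}_{A,Ω} + m² ≥ m²`** ((2.17); the Neumann form is `≥ 0`,
`HiggsCovariancePos.siteInner_covLaplacianN_nonneg`). [cite: Balaban1982Higgs1, (2.17) p.610] -/
theorem siteInner_deltaKA_zero_ge (msq a : ℝ) (f : ScalarField P 0 N) :
    msq * siteInner f f ≤ siteInner f (deltaKA C Ω A msq a 0 f) := by
  simp only [deltaKA_zero, delta0, LinearMap.add_apply, LinearMap.smul_apply, LinearMap.id_apply,
    siteInner_add_right, siteInner_smul_right]
  linarith [siteInner_covLaplacianN_nonneg C Ω A f]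

/-- **`Δ^{(k),L^kε}(Ω, A) > 0` for `1 ≤ k ≤ K`**, every `A`, `Ω`, `C` (m² > 0, a > 0, L > 1): `0 < ⟨ψ, Δ^{(k)}(Ω,A)ψ⟩` for
`ψ ≠ 0` — by (2.21), the variational inequality `a_k(L^kε)^{−2}⟨Q^*_kψ, G^ε_kQ^*_kψ⟩ < ⟨ψ,ψ⟩`: with `f = Q^*_kψ ≠ 0`,
`φ = G^ε_kf`, `X = ⟨f,φ⟩ = ⟨φ,(−Δ+m²)φ⟩ + c|Q_kφ|² > c|Q_kφ|²` and `X = ⟨ψ, Q_kφ⟩ ≤ |ψ||Q_kφ|`. PROVED.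
[cite: Balaban1982Higgs1, (2.21) p.610] -/
theorem siteInner_deltaKA_succ_pos {msq a : ℝ} (hmsq : 0 < msq) (ha : 0 < a) (hL : 1 < (P.L : ℝ)) {j : ℕ}
    (hj : j + 1 ≤ P.K) {ψ : ScalarField P (j + 1) N} (hψ : ψ ≠ 0) :
    0 < siteInner ψ (deltaKA C Ω A msq a (j + 1) ψ) := by
  have hc : 0 < coeff221 P a (j + 1) := coeff221_pos ha hL (Nat.succ_le_succ (Nat.zero_le j))
  have hak : 0 ≤ B1.aSeq a P.L (j + 1) := (B1.aSeq_pos ha hL (Nat.succ_le_succ (Nat.zero_le j))).le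
  have hspos : 0 < sNorm ψ :=
    lt_of_le_of_ne (sNorm_nonneg _) fun h => hψ ((sNorm_eq_zero_iff ψ).mp h.symm)
  set c : ℝ := coeff221 P a (j + 1) with hc_def
  set f : ScalarField P 0 N := avgQkAdj C A (j + 1) ψ with hf_def
  set φ : ScalarField P 0 N := propagatorK C Ω A msq a (j + 1) f with hφ_def
  set s : ℝ := sNorm ψ with hs_def
  set u : ℝ := sNorm (avgQkLin C A (j + 1) φ) with hu_def
  have hu0 : 0 ≤ u := sNorm_nonneg _
  -- `(−Δ^{ε,N}_{A,Ω} + m² + cP_k(A))φ = f`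
  have hsolve : covOpK C Ω A msq a (j + 1) φ = f := covOpK_propagatorK_apply C Ω A hmsq a (j + 1) hak f
  -- `f ≠ 0`, hence `φ ≠ 0`
  have hf : f ≠ 0 := fun h => hψ (eq_zero_of_avgQkAdj_eq_zero C A hj h)
  have hφ : φ ≠ 0 := by
    intro h
    apply hf
    rw [← hsolve, h, map_zero]
  have hφpos : 0 < siteInner φ φ := siteInner_self_pos hφ
  -- `X := ⟨f, φ⟩ = ⟨φ, (−Δ^{ε,N}_{A,Ω})φ⟩ + m²|φ|² + c|Q_k(A)φ|²`
  have hX : siteInner f φ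
      = siteInner φ (covLaplacianN C Ω A φ) + msq * siteInner φ φ + c * u ^ 2 := by
    have h1 : siteInner f φ = siteInner φ (covOpK C Ω A msq a (j + 1) φ) := by
      rw [hsolve, siteInner_comm]
    rw [h1, covOpK_eq_coeff221, ← hc_def, LinearMap.add_apply, LinearMap.add_apply, LinearMap.smul_apply,
      LinearMap.smul_apply, LinearMap.id_apply, LinearMap.comp_apply, siteInner_add_right, siteInner_add_right,
      siteInner_smul_right, siteInner_smul_right, siteInner_projPk_eq, ← sNorm_sq (avgQkLin C A (j + 1) φ),
      ← hu_def]
  -- `X = ⟨ψ, Q_k(A)φ⟩ ≤ |ψ||Q_k(A)φ|`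
  have hadj : siteInner f φ = siteInner ψ (avgQkLin C A (j + 1) φ) := by
    rw [hf_def, siteInner_comm, ← siteInner_avgQkLin, siteInner_comm]
  have hXle : siteInner f φ ≤ s * u := by
    rw [hadj]
    exact siteInner_le_sNorm_mul _ _
  -- `X > c|Q_k(A)φ|²`
  have hXgt : c * u ^ 2 < siteInner f φ := by
    rw [hX]
    have := siteInner_covLaplacianN_nonneg C Ω A φ
    nlinarith [mul_pos hmsq hφpos]
  -- hence `u > 0`, `cu < s`, `cX < s²`
  have hupos : 0 < u := by
    rcases hu0.lt_or_eq with h | h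
    · exact h
    · exfalso
      rw [← h] at hXgt hXle
      nlinarith
  have hcu : c * u < s := by
    by_contra hnot
    have hle : s ≤ c * u := not_lt.mp hnot
    have : s * u ≤ (c * u) * u := mul_le_mul_of_nonneg_right hle hu0
    nlinarith
  have hcX : c * siteInner f φ < s ^ 2 := by
    have h1 : c * siteInner f φ ≤ c * (s * u) := mul_le_mul_of_nonneg_left hXle hc.le
    have h2 : (c * u) * s < s * s := mul_lt_mul_of_pos_right hcu hspos
    nlinarith
  -- (2.21): `⟨ψ, Δ^{(k)}ψ⟩ = c|ψ|² − c²X`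
  rw [siteInner_deltaKA_succ, ← hc_def, ← hf_def, ← hφ_def, ← hadj, ← sNorm_sq, ← hs_def]
  nlinarith [mul_pos hc (sub_pos.mpr hcX)]

/-- **The operator of (2.30) is positive definite** — the qualitative half of (2.33) *"γ₀I ≦ aL^{−2}P(A) + Δ^{(k)}(Ω, A)"*
WITHOUT the uniform constant: `0 < ⟨f, (a(L^{k+1}ε)^{−2}P(A) + Δ^{(k),L^kε}(Ω,A))f⟩` for `f ≠ 0`, every `A`, `Ω`, `C`
(m² > 0, a > 0, L > 1, k ≤ K). PROVED. [cite: Balaban1982Higgs1, (2.33) p.611] -/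
theorem siteInner_precOpA_pos {msq a : ℝ} (hmsq : 0 < msq) (ha : 0 < a) (hL : 1 < (P.L : ℝ)) {j : ℕ}
    (hj : j ≤ P.K) {f : ScalarField P j N} (hf : f ≠ 0) : 0 < siteInner f (precOpA C Ω A msq a j f) := by
  rw [precOpA, LinearMap.add_apply, LinearMap.smul_apply, siteInner_add_right, siteInner_smul_right]
  have hP := siteInner_blockProjA_nonneg C A j f
  have hcoef : 0 ≤ a * ((P.mesh (j + 1))⁻¹ ^ 2) := mul_nonneg ha.le (sq_nonneg _)
  have hΔ : 0 < siteInner f (deltaKA C Ω A msq a j f) := by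
    cases j with
    | zero =>
        have h0 := siteInner_deltaKA_zero_ge C Ω A msq a f
        nlinarith [mul_pos hmsq (siteInner_self_pos hf)]
    | succ j => exact siteInner_deltaKA_succ_pos C Ω A hmsq ha hL hj hf
  nlinarith [mul_nonneg hcoef hP]

/-- **"It is so" (p. 611) at every level `k ≤ K`, including `k = 0`**: the operator of (2.30) is a unit of the
endomorphism ring (positive definite on a finite-dimensional space; p35's `B1Eq230FluctCov.isUnit_precOpA` is the case
`1 ≤ k` by the abstract route `B1RG242`). PROVED. [cite: Balaban1982Higgs1, (2.30) p.611] -/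
theorem isUnit_precOpA_of_le {msq a : ℝ} (hmsq : 0 < msq) (ha : 0 < a) (hL : 1 < (P.L : ℝ)) {j : ℕ} (hj : j ≤ P.K) :
    IsUnit (precOpA C Ω A msq a j : Module.End ℝ (ScalarField P j N)) := by
  rw [LinearMap.isUnit_iff_ker_eq_bot, LinearMap.ker_eq_bot']
  intro f hf0
  by_contra hne
  have h := siteInner_precOpA_pos C Ω A hmsq ha hL hj hne
  rw [hf0, siteInner_zero_right] at h
  exact lt_irrefl _ h

/-- `(a(L^{k+1}ε)^{−2}P(A) + Δ^{(k)}(Ω,A)) · C^{(k)}(Ω,A) = 1` whenever the operator of (2.30) is a unit.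
[cite: Balaban1982Higgs1, (2.30) p.611] -/
theorem precOpA_mul_fluctCovA {msq a : ℝ} {j : ℕ}
    (hU : IsUnit (precOpA C Ω A msq a j : Module.End ℝ (ScalarField P j N))) :
    (precOpA C Ω A msq a j : Module.End ℝ (ScalarField P j N)) * fluctCovA C Ω A msq a j = 1 :=
  Ring.mul_inverse_cancel _ hU

/-- `C^{(k)}(Ω,A) · (a(L^{k+1}ε)^{−2}P(A) + Δ^{(k)}(Ω,A)) = 1` whenever the operator of (2.30) is a unit.
[cite: Balaban1982Higgs1, (2.30) p.611] -/
theorem fluctCovA_mul_precOpA {msq a : ℝ} {j : ℕ}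
    (hU : IsUnit (precOpA C Ω A msq a j : Module.End ℝ (ScalarField P j N))) :
    fluctCovA C Ω A msq a j * (precOpA C Ω A msq a j : Module.End ℝ (ScalarField P j N)) = 1 :=
  Ring.inverse_mul_cancel _ hU

/-- Applied form: `(a(L^{k+1}ε)^{−2}P(A) + Δ^{(k)}(Ω,A))(C^{(k)}(Ω,A)g) = g`. [cite: Balaban1982Higgs1, (2.30) p.611] -/
theorem precOpA_fluctCovA_apply {msq a : ℝ} {j : ℕ}
    (hU : IsUnit (precOpA C Ω A msq a j : Module.End ℝ (ScalarField P j N))) (g : ScalarField P j N) :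
    precOpA C Ω A msq a j (fluctCovA C Ω A msq a j g) = g := by
  have h := congrArg (fun T : Module.End ℝ (ScalarField P j N) => T g) (precOpA_mul_fluctCovA C Ω A hU)
  simpa using h

/-- Applied form: `C^{(k)}(Ω,A)((a(L^{k+1}ε)^{−2}P(A) + Δ^{(k)}(Ω,A))f) = f`. [cite: Balaban1982Higgs1, (2.30) p.611] -/
theorem fluctCovA_precOpA_apply {msq a : ℝ} {j : ℕ}
    (hU : IsUnit (precOpA C Ω A msq a j : Module.End ℝ (ScalarField P j N))) (f : ScalarField P j N) :
    fluctCovA C Ω A msq a j (precOpA C Ω A msq a j f) = f := by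
  have h := congrArg (fun T : Module.End ℝ (ScalarField P j N) => T f) (fluctCovA_mul_precOpA C Ω A hU)
  simpa using h

/-- **`C^{(k),L^kε}(Ω, A) > 0`**: `0 < ⟨g, C^{(k)}(Ω,A)g⟩` for `g ≠ 0` (m² > 0, a > 0, L > 1, k ≤ K) — the inverse of a
symmetric positive definite operator. PROVED. [cite: Balaban1982Higgs1, (2.30) p.611] -/
theorem siteInner_fluctCovA_pos {msq a : ℝ} (hmsq : 0 < msq) (ha : 0 < a) (hL : 1 < (P.L : ℝ)) {j : ℕ}
    (hj : j ≤ P.K) {g : ScalarField P j N} (hg : g ≠ 0) : 0 < siteInner g (fluctCovA C Ω A msq a j g) := by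
  have hU := isUnit_precOpA_of_le C Ω A hmsq ha hL hj
  have hMφ : precOpA C Ω A msq a j (fluctCovA C Ω A msq a j g) = g := precOpA_fluctCovA_apply C Ω A hU g
  have hφ0 : fluctCovA C Ω A msq a j g ≠ 0 := by
    intro h
    apply hg
    rw [← hMφ, h, map_zero]
  calc (0 : ℝ) < siteInner (fluctCovA C Ω A msq a j g) (precOpA C Ω A msq a j (fluctCovA C Ω A msq a j g)) :=
        siteInner_precOpA_pos C Ω A hmsq ha hL hj hφ0
    _ = siteInner g (fluctCovA C Ω A msq a j g) := by rw [hMφ, siteInner_comm]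

/-- `C^{(k),L^kε}(Ω, A) ≥ 0`: `0 ≤ ⟨g, C^{(k)}(Ω,A)g⟩` for every `g` (m² > 0, a > 0, L > 1, k ≤ K). [cite: Balaban1982Higgs1, (2.30) p.611] -/
theorem siteInner_fluctCovA_nonneg {msq a : ℝ} (hmsq : 0 < msq) (ha : 0 < a) (hL : 1 < (P.L : ℝ)) {j : ℕ}
    (hj : j ≤ P.K) (g : ScalarField P j N) : 0 ≤ siteInner g (fluctCovA C Ω A msq a j g) := by
  by_cases hg : g = 0
  · rw [hg, map_zero, siteInner_zero_right]
  · exact (siteInner_fluctCovA_pos C Ω A hmsq ha hL hj hg).le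

end Positivity

/-! ## §3 The unit-lattice letters of (2.31): `aL^{−2}` and `a_k` on `Params.unitAt k` -/

section UnitLattice

/-- On the rescaled family `P.unitAt k` (spacing `L^{−k}` at level `0`, `1` at level `k`; (2.22)) the coefficient
`a(L^{k+1}η)^{−2}` of `P(A)` in (2.30) IS the printed `aL^{−2}` of (2.31) *"C^{(k)}(Ω, A) = (aL^{−2}P(A) + Δ^{(k)}(Ω, A))^{−1}"*.
[cite: Balaban1982Higgs1, (2.31) p.611] -/
theorem stepCoeff_unitAt (a : ℝ) (k : ℕ) :
    a * (((P.unitAt k).mesh (k + 1))⁻¹ ^ 2) = a * ((P.L : ℝ) ^ 2)⁻¹ := by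
  have hmesh : (P.unitAt k).mesh (k + 1) = P.L := by
    have h1 := mesh_unitAt_self P k
    unfold HiggsLattice.Params.mesh at h1 ⊢
    rw [pow_succ, mul_comm (((P.unitAt k).L : ℝ) ^ k), mul_assoc, h1, mul_one]
    rfl
  rw [hmesh, inv_pow]

/-- On `P.unitAt k` the coefficient `a_k(L^kη)^{−2}` of (2.21) IS the printed `a_k` of (2.22)/(2.31)
(`HiggsCovariance.mesh_unitAt_self`). [cite: Balaban1982Higgs1, (2.31) p.611] -/
theorem coeff221_unitAt (a : ℝ) (k : ℕ) : coeff221 (P.unitAt k) a k = B1.aSeq a P.L k := by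
  rw [coeff221_eq, mesh_unitAt_self, inv_one, one_pow, mul_one]
  rfl

/-- Hence on `P.unitAt k` the operator of (2.30) reads literally `aL^{−2}P(A) + Δ^{(k)}(Ω, A)` — the operator inverted
in (2.31) and restricted in (2.32). [cite: Balaban1982Higgs1, (2.31) p.611] -/
theorem precOpA_unitAt (C : ChargeData N) (k : ℕ) (Ω : Finset (HiggsLattice.Site (P.unitAt k) 0))
    (A : HiggsLattice.VecField (P.unitAt k) 0) (msq a : ℝ) :
    precOpA C Ω A msq a k = (a * ((P.L : ℝ) ^ 2)⁻¹) • blockProjA C A k + deltaKA C Ω A msq a k := by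
  rw [precOpA, stepCoeff_unitAt]

end UnitLattice

end Literature.MathematicalPhysics.QuantumFieldTheory.Balaban1983to89.B1Eq230FluctCovPos
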